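import Summits.Ventures.YMGap.Thresholds.ConnectedFourPointDecay
import Summits.Ventures.YMGap.Thresholds.ConnectedFourPointBoundsDim
import HarnessLib

/-!
# Venture YMGap — C-SUS4 every `d`, every `N`: TREE DECAY OF THE CONNECTED FOUR-POINT FUNCTION of the `SU(N)`
# strong-coupling state on `ℤ^d` (Dobrushin door window), one constant for the whole window — twin of `ConnectedFourPointDecay`

HONEST FRAMING: venture file of the cell `pub-ymgap` (QuantumFields programme), seat ds-1 (gen 10).  Strong-coupling LATTICE
statements for `SU(N)` lattice Yang–Mills on `ℤ^d` with the Wilson action inside the Dobrushin door window `doorPoly d (K b₁/N) < 1`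
under `OneLinkKRModulus N R K`; cumulant estimates of the unique DLR state only; nothing about the continuum or the Clay problem.

* `exp_neg_ninth_supNorm_le_pow_dim` — `e^{−(κ/9)‖z‖_∞} ≤ (e^{−κ/(9d)})^{‖z‖₁}` on `ℤ^d`;
* ★ `abs_fourPoint_le_dim` — `|u₄(F; W_q; W_r; W_s)| ≤ A₄ ρ^{‖x₀−x_q‖₁} ρ^{‖x₀−x_r‖₁} ρ^{‖x₀−x_s‖₁}`, `ρ = e^{−κ_d/(9d)}`,
  `A₄ = 4(2√N)² e^{κ_d(D+4)} · 40 (#Λ+4)² (|F 1|+2K+1)² (K+4N³)²` (seven bipartitions + `tree_bound_of_seven_splits`).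
-/

noncomputable section

open MeasureTheory ProbabilityTheory Function Finset Filter Topology Real Set
open scoped NNReal
open Literature.MathematicalPhysics.QuantumLattice (LGConfig ZdEdge ZdPlaquette plaquetteEdges fundamentalRep ymGibbsMeasures)
open Literature.MathematicalPhysics.QuantumFieldTheory hiding ZdEdge
open Literature.MathematicalPhysics.QuantumFieldTheory.Balaban1983to89.StrongCouplingDobrushinWindow (OneLinkKRModulus)
open Summit.Ventures.YMGap.StarResolventDim (gaugeR doorPoly)
open Summit.Ventures.YMGap.StarDimLimit (dimRate_pos)
open Summit.Ventures.YMGap.RobustBall (l1)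

namespace Summit.Ventures.YMGap.CouplingResponse

/-- Local shorthand: the any-`d` Dobrushin–Shlosman rate `κ_d(R_G^{(d)}(c)) = (1 − ρ)²/(2(2ρ·2d + 1))`, `ρ = R_G^{(d)}(c)`. -/
local notation3 (prettyPrint := false) "dimκ(" d' ", " c ")" =>
  (1 - gaugeR d' c) ^ 2 / (2 * (2 * gaugeR d' c * ((2 * d' : ℕ) : ℝ) + 1))

/-! ### Tree decay of the connected four-point function, every `d` -/

section FourPoint

variable {d N : ℕ}

/-- Local shorthand: the normalised plaquette observable `W_q = (1/N) Re tr U_q` of `SU(N)` on `ℤ^d`. -/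
local notation3 (prettyPrint := false) "W∗" q:max =>
  zdPlaquetteObs (d := d) (fundamentalRep (Fin N)) (Prod.fst q) (Prod.snd q).1.1 (Prod.snd q).1.2

/-- Local shorthand: the connected three-point function `u₃(X; Y; Z)` under `μ`. -/
local notation3 (prettyPrint := false) "U₃[" X ";" Y ";" Z ";" μ "]" =>
  cov[fun ω => X ω * Y ω, Z; μ] - (∫ ω, X ω ∂μ) * cov[Y, Z; μ] - (∫ ω, Y ω ∂μ) * cov[X, Z; μ]

/-- Local shorthand: the connected four-point function in derivative form `u₄(X; Y; Z; W)` under `μ`. -/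
local notation3 (prettyPrint := false) "U₄[" X ";" Y ";" Z ";" W ";" μ "]" =>
  (cov[fun ω => (X ω * Y ω) * Z ω, W; μ] - (∫ ω, X ω * Y ω ∂μ) * cov[Z, W; μ] - (∫ ω, Z ω ∂μ) * cov[fun ω => X ω * Y ω, W; μ])
  - cov[X, W; μ] * cov[Y, Z; μ] - (∫ ω, X ω ∂μ) * U₃[Y ; Z ; W ; μ]
  - cov[Y, W; μ] * cov[X, Z; μ] - (∫ ω, Y ω ∂μ) * U₃[X ; Z ; W ; μ]

/-- `e^{−(κ/9)‖z‖_∞} ≤ (e^{−κ/(9d)})^{‖z‖₁}` on `ℤ^d`. [folklore] -/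
theorem exp_neg_ninth_supNorm_le_pow_dim {κ : ℝ} (hκ : 0 ≤ κ) (hd : 1 ≤ d) (z : Literature.Probability.LatticeModels.Site d) :
    Real.exp (-(κ / 9 * ‖z‖)) ≤ Real.exp (-(κ / (9 * d))) ^ l1 z := by
  have h := exp_neg_quarter_supNorm_le_pow_dim (κ := 4 * κ / 9) (by positivity) hd z
  have hd0 : (0 : ℝ) < d := by exact_mod_cast (show 0 < d by omega)
  have e1 : 4 * κ / 9 / 4 = κ / 9 := by ring
  have e2 : 4 * κ / 9 / (4 * (d : ℝ)) = κ / (9 * d) := by field_simp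
  rw [e1, e2] at h
  exact h

/-- ★ **TREE DECAY OF THE CONNECTED FOUR-POINT FUNCTION, every `d`, every `N`** (ONE constant for the whole window).
For the `SU(N)` DLR state on `ℤ^d` at tree coupling `0 ≤ b ≤ b₁` inside the door window, `κ = κ_d`, `ρ = e^{−κ/(9d)}`, a Lipschitz
cylinder `F` (support `Λ`, constant `K_F`, links within sup-distance `D` of `x₀`) and all plaquettes `q, r, s`:
`|u₄(F; W_q; W_r; W_s)| ≤ A₄ · ρ^{‖x₀−x_q‖₁} ρ^{‖x₀−x_r‖₁} ρ^{‖x₀−x_s‖₁}`,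
`A₄ = 4(2√N)² e^{κ(D+4)} · 40 (#Λ+4)² (|F 1|+2K_F+1)² (K_F+4N³)²` — seven bipartitions and `tree_bound_of_seven_splits`. -/
theorem abs_fourPoint_le_dim (hd : 2 ≤ d) (hN : 1 ≤ N) {R K b₁ : ℝ} (hK0 : 0 ≤ K)
    (hmod : OneLinkKRModulus N R K) (hR : b₁ / N * (2 * ((d : ℝ) - 1)) ≤ R) (hdoor : doorPoly d (K * (b₁ / N)) < 1)
    {b : ℝ} (h0 : 0 ≤ b) (hb : b ≤ b₁)
    {μ : Measure (LGConfig d (Matrix.specialUnitaryGroup (Fin N) ℂ))}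
    (hμ : μ ∈ ymGibbsMeasures (d := d) (fundamentalRep (Fin N)) b)
    {F : LGConfig d (Matrix.specialUnitaryGroup (Fin N) ℂ) → ℝ} {Λ : Finset (ZdEdge d)} {KF : ℝ≥0}
    (hF : IsLipschitzCylinder (fundamentalRep (Fin N)) F Λ KF)
    {x₀ : Literature.Probability.LatticeModels.Site d} {D : ℕ} (hD : ∀ e ∈ Λ, ‖e.1 - x₀‖ ≤ D)
    (q r s : ZdPlaquette d) :
    |U₄[F ; W∗ q ; W∗ r ; W∗ s ; μ]| ≤
      4 * (2 * Real.sqrt N) ^ 2 * Real.exp (dimκ(d, K * (b₁ / N)) * (D + 4)) *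
        (40 * ((Λ.card : ℝ) + 4) ^ 2 * (|F 1| + 2 * KF + 1) ^ 2 * ((KF : ℝ) + 4 * (N : ℝ) ^ 3) ^ 2) *
        Real.exp (-(dimκ(d, K * (b₁ / N)) / (9 * d))) ^ l1 (x₀ - q.1) * Real.exp (-(dimκ(d, K * (b₁ / N)) / (9 * d))) ^ l1 (x₀ - r.1) *
        Real.exp (-(dimκ(d, K * (b₁ / N)) / (9 * d))) ^ l1 (x₀ - s.1) := by
  classical
  haveI : IsProbabilityMeasure μ := hμ.1
  have hN0 : (0 : ℝ) < N := by exact_mod_cast (show 0 < N by omega)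
  have hb₁N : 0 ≤ b₁ / N := div_nonneg (h0.trans hb) hN0.le
  obtain ⟨hρ0, hρ1⟩ := gaugeR_dim_coef_lt_one (N := N) hd hK0 hb₁N hdoor
  have hκ : 0 < dimκ(d, K * (b₁ / N)) := dimRate_pos (d := d) hρ0 hρ1
  set κ := dimκ(d, K * (b₁ / N)) with hκdef
  obtain ⟨hWq, hWqm, hWq1, hq1, -⟩ := plaquetteObs_data_dim (N := N) q
  obtain ⟨hWr, hWrm, hWr1, hr1, -⟩ := plaquetteObs_data_dim (N := N) r
  obtain ⟨hWs, hWsm, hWs1, hs1, -⟩ := plaquetteObs_data_dim (N := N) s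
  -- uniform data `(n, L, M)` as opaque names
  obtain ⟨MF, hMFdef⟩ : ∃ M : ℝ≥0, (M : ℝ) = |F 1| + 2 * KF := ⟨⟨|F 1| + 2 * KF, by positivity⟩, rfl⟩
  have hFM : ∀ U, |F U| ≤ (MF : ℝ) := fun U => by rw [hMFdef]; exact hF.abs_le U
  obtain ⟨nN, hnN⟩ : ∃ n : ℕ, n = Λ.card + 4 := ⟨_, rfl⟩
  obtain ⟨LN, hLN⟩ : ∃ L : ℝ≥0, L = KF + 4 * (N : ℝ≥0) ^ 3 := ⟨_, rfl⟩
  obtain ⟨MN, hMN⟩ : ∃ M : ℝ≥0, M = MF + 1 := ⟨_, rfl⟩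
  have hnF : Λ.card ≤ nN := by omega
  have hnq : (plaquetteEdges q).card ≤ nN := (card_plaquetteEdges_le q).trans (by omega)
  have hnr : (plaquetteEdges r).card ≤ nN := (card_plaquetteEdges_le r).trans (by omega)
  have hns : (plaquetteEdges s).card ≤ nN := (card_plaquetteEdges_le s).trans (by omega)
  have hLF : KF ≤ LN := by rw [hLN]; exact le_add_of_nonneg_right (by positivity)
  have hLW : (4 * (N : ℝ≥0) ^ 3) ≤ LN := by rw [hLN]; exact le_add_of_nonneg_left (by positivity)
  have hMF' : MF ≤ MN := by rw [hMN]; exact le_add_of_nonneg_right zero_le_one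
  have hMW : (1 : ℝ≥0) ≤ MN := by rw [hMN]; exact le_add_of_nonneg_left (by positivity)
  -- base-point distances
  obtain ⟨d01, hd01⟩ : ∃ n : ℕ, n = Literature.Probability.LatticeModels.Site.supNorm (x₀ - q.1) := ⟨_, rfl⟩
  obtain ⟨d02, hd02⟩ : ∃ n : ℕ, n = Literature.Probability.LatticeModels.Site.supNorm (x₀ - r.1) := ⟨_, rfl⟩
  obtain ⟨d03, hd03⟩ : ∃ n : ℕ, n = Literature.Probability.LatticeModels.Site.supNorm (x₀ - s.1) := ⟨_, rfl⟩
  obtain ⟨d12, hd12⟩ : ∃ n : ℕ, n = Literature.Probability.LatticeModels.Site.supNorm (q.1 - r.1) := ⟨_, rfl⟩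
  obtain ⟨d13, hd13⟩ : ∃ n : ℕ, n = Literature.Probability.LatticeModels.Site.supNorm (q.1 - s.1) := ⟨_, rfl⟩
  obtain ⟨d23, hd23⟩ : ∃ n : ℕ, n = Literature.Probability.LatticeModels.Site.supNorm (r.1 - s.1) := ⟨_, rfl⟩
  have R01 : ‖x₀ - q.1‖ = d01 := by rw [hd01]; exact Literature.Probability.LatticeModels.Site.norm_eq_supNorm _
  have R02 : ‖x₀ - r.1‖ = d02 := by rw [hd02]; exact Literature.Probability.LatticeModels.Site.norm_eq_supNorm _
  have R03 : ‖x₀ - s.1‖ = d03 := by rw [hd03]; exact Literature.Probability.LatticeModels.Site.norm_eq_supNorm _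
  have R12 : ‖q.1 - r.1‖ = d12 := by rw [hd12]; exact Literature.Probability.LatticeModels.Site.norm_eq_supNorm _
  have R13 : ‖q.1 - s.1‖ = d13 := by rw [hd13]; exact Literature.Probability.LatticeModels.Site.norm_eq_supNorm _
  have R23 : ‖r.1 - s.1‖ = d23 := by rw [hd23]; exact Literature.Probability.LatticeModels.Site.norm_eq_supNorm _
  have nsym : ∀ (u v : Literature.Probability.LatticeModels.Site d),
      Literature.Probability.LatticeModels.Site.supNorm (v - u) = Literature.Probability.LatticeModels.Site.supNorm (u - v) := by
    intro u v
    have h1 : ‖v - u‖ = (Literature.Probability.LatticeModels.Site.supNorm (v - u) : ℝ) :=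
      Literature.Probability.LatticeModels.Site.norm_eq_supNorm _
    have h2 : ‖u - v‖ = (Literature.Probability.LatticeModels.Site.supNorm (u - v) : ℝ) :=
      Literature.Probability.LatticeModels.Site.norm_eq_supNorm _
    rw [norm_sub_rev, h2] at h1
    exact_mod_cast h1.symm
  -- triangle inequalities through `x₀`
  have tri : ∀ {u v w : Literature.Probability.LatticeModels.Site d} {a b c : ℕ},
      ‖u - v‖ = a → ‖u - w‖ = b → ‖v - w‖ = c → a ≤ b + c := by
    intro u v w a b c ha hb hc
    have h : ‖u - v‖ ≤ ‖u - w‖ + ‖v - w‖ := by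
      calc ‖u - v‖ = ‖(u - w) - (v - w)‖ := by congr 1; abel
        _ ≤ ‖u - w‖ + ‖v - w‖ := norm_sub_le _ _
    rw [ha, hb, hc] at h
    exact_mod_cast h
  have R21 : ‖r.1 - q.1‖ = d12 := by rw [norm_sub_rev]; exact R12
  have R31 : ‖s.1 - q.1‖ = d13 := by rw [norm_sub_rev]; exact R13
  have R32 : ‖s.1 - r.1‖ = d23 := by rw [norm_sub_rev]; exact R23
  have t12 : d01 ≤ d02 + d12 := tri R01 R02 R12
  have t13 : d01 ≤ d03 + d13 := tri R01 R03 R13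
  have t21 : d02 ≤ d01 + d12 := tri R02 R01 R21
  have t23 : d02 ≤ d03 + d23 := tri R02 R03 R23
  have t31 : d03 ≤ d01 + d13 := tri R03 R01 R31
  have t32 : d03 ≤ d02 + d23 := tri R03 R02 R32
  -- pairwise separations of the clusters
  have S01 : ∀ {m : ℕ}, m ≤ d01 - (D + 2) → ∀ a ∈ Λ, ∀ b ∈ plaquetteEdges q, (m : ℝ) ≤ ‖a.1 - b.1‖ :=
    fun hm => sep_of_near_dim hD hq1 (by rw [← hd01]; omega)
  have S02 : ∀ {m : ℕ}, m ≤ d02 - (D + 2) → ∀ a ∈ Λ, ∀ b ∈ plaquetteEdges r, (m : ℝ) ≤ ‖a.1 - b.1‖ :=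
    fun hm => sep_of_near_dim hD hr1 (by rw [← hd02]; omega)
  have S03 : ∀ {m : ℕ}, m ≤ d03 - (D + 2) → ∀ a ∈ Λ, ∀ b ∈ plaquetteEdges s, (m : ℝ) ≤ ‖a.1 - b.1‖ :=
    fun hm => sep_of_near_dim hD hs1 (by rw [← hd03]; omega)
  have S10 : ∀ {m : ℕ}, m ≤ d01 - (D + 2) → ∀ a ∈ plaquetteEdges q, ∀ b ∈ Λ, (m : ℝ) ≤ ‖a.1 - b.1‖ :=
    fun hm => sep_of_near_dim hq1 hD (by rw [nsym, ← hd01]; omega)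
  have S20 : ∀ {m : ℕ}, m ≤ d02 - (D + 2) → ∀ a ∈ plaquetteEdges r, ∀ b ∈ Λ, (m : ℝ) ≤ ‖a.1 - b.1‖ :=
    fun hm => sep_of_near_dim hr1 hD (by rw [nsym, ← hd02]; omega)
  have S30 : ∀ {m : ℕ}, m ≤ d03 - (D + 2) → ∀ a ∈ plaquetteEdges s, ∀ b ∈ Λ, (m : ℝ) ≤ ‖a.1 - b.1‖ :=
    fun hm => sep_of_near_dim hs1 hD (by rw [nsym, ← hd03]; omega)
  have S12 : ∀ {m : ℕ}, m ≤ d12 - (D + 2) → ∀ a ∈ plaquetteEdges q, ∀ b ∈ plaquetteEdges r, (m : ℝ) ≤ ‖a.1 - b.1‖ :=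
    fun hm => sep_of_near_dim hq1 hr1 (by rw [← hd12]; omega)
  have S21 : ∀ {m : ℕ}, m ≤ d12 - (D + 2) → ∀ a ∈ plaquetteEdges r, ∀ b ∈ plaquetteEdges q, (m : ℝ) ≤ ‖a.1 - b.1‖ :=
    fun hm => sep_of_near_dim hr1 hq1 (by rw [nsym, ← hd12]; omega)
  have S13 : ∀ {m : ℕ}, m ≤ d13 - (D + 2) → ∀ a ∈ plaquetteEdges q, ∀ b ∈ plaquetteEdges s, (m : ℝ) ≤ ‖a.1 - b.1‖ :=
    fun hm => sep_of_near_dim hq1 hs1 (by rw [← hd13]; omega)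
  have S31 : ∀ {m : ℕ}, m ≤ d13 - (D + 2) → ∀ a ∈ plaquetteEdges s, ∀ b ∈ plaquetteEdges q, (m : ℝ) ≤ ‖a.1 - b.1‖ :=
    fun hm => sep_of_near_dim hs1 hq1 (by rw [nsym, ← hd13]; omega)
  have S23 : ∀ {m : ℕ}, m ≤ d23 - (D + 2) → ∀ a ∈ plaquetteEdges r, ∀ b ∈ plaquetteEdges s, (m : ℝ) ≤ ‖a.1 - b.1‖ :=
    fun hm => sep_of_near_dim hr1 hs1 (by rw [← hd23]; omega)
  have S32 : ∀ {m : ℕ}, m ≤ d23 - (D + 2) → ∀ a ∈ plaquetteEdges s, ∀ b ∈ plaquetteEdges r, (m : ℝ) ≤ ‖a.1 - b.1‖ :=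
    fun hm => sep_of_near_dim hs1 hr1 (by rw [nsym, ← hd23]; omega)
  have U2 : ∀ {S₁ S₂ T : Finset (ZdEdge d)} {m : ℕ}, (∀ a ∈ S₁, ∀ b ∈ T, (m : ℝ) ≤ ‖a.1 - b.1‖) →
      (∀ a ∈ S₂, ∀ b ∈ T, (m : ℝ) ≤ ‖a.1 - b.1‖) → ∀ a ∈ S₁ ∪ S₂, ∀ b ∈ T, (m : ℝ) ≤ ‖a.1 - b.1‖ :=
    fun h₁ h₂ => Finset.forall_mem_union.2 ⟨h₁, h₂⟩
  have T2 : ∀ {S T₁ T₂ : Finset (ZdEdge d)} {m : ℕ}, (∀ a ∈ S, ∀ b ∈ T₁, (m : ℝ) ≤ ‖a.1 - b.1‖) →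
      (∀ a ∈ S, ∀ b ∈ T₂, (m : ℝ) ≤ ‖a.1 - b.1‖) → ∀ a ∈ S, ∀ b ∈ T₁ ∪ T₂, (m : ℝ) ≤ ‖a.1 - b.1‖ :=
    fun h₁ h₂ a ha => Finset.forall_mem_union.2 ⟨h₁ a ha, h₂ a ha⟩
  -- the common constant after the truncation bookkeeping
  obtain ⟨P₀, hP₀⟩ : ∃ P : ℝ, P = 4 * (2 * Real.sqrt N) ^ 2 * Real.exp (κ * (D + 4)) *
      (40 * (nN : ℝ) ^ 2 * (MN : ℝ) ^ 2 * (LN : ℝ) ^ 2) := ⟨_, rfl⟩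
  have hP₀0 : 0 ≤ P₀ := by rw [hP₀]; positivity
  have pack : ∀ {g : ℕ} {c : ℝ}, 0 ≤ c → c ≤ 40 →
      |U₄[F ; W∗ q ; W∗ r ; W∗ s ; μ]| ≤ 4 * (2 * Real.sqrt N) ^ 2 *
        Real.exp (-(κ * (((g - (D + 2) : ℕ) - 2 : ℕ) : ℝ))) * (c * (nN : ℝ) ^ 2 * (MN : ℝ) ^ 2 * (LN : ℝ) ^ 2) →
      |U₄[F ; W∗ q ; W∗ r ; W∗ s ; μ]| ≤ P₀ * Real.exp (-(κ * g)) := by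
    intro g c hc0 hc h
    refine h.trans ?_
    rw [hP₀]
    have he := exp_trunc_sub_le hκ.le g D
    have hq : (0 : ℝ) ≤ (nN : ℝ) ^ 2 * (MN : ℝ) ^ 2 * (LN : ℝ) ^ 2 := by positivity
    have hcq : 0 ≤ c * (nN : ℝ) ^ 2 * (MN : ℝ) ^ 2 * (LN : ℝ) ^ 2 := by
      have := mul_nonneg hc0 hq; linarith [this, show c * (nN : ℝ) ^ 2 * (MN : ℝ) ^ 2 * (LN : ℝ) ^ 2 =
        c * ((nN : ℝ) ^ 2 * (MN : ℝ) ^ 2 * (LN : ℝ) ^ 2) by ring]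
    have hc' : c * (nN : ℝ) ^ 2 * (MN : ℝ) ^ 2 * (LN : ℝ) ^ 2 ≤ 40 * (nN : ℝ) ^ 2 * (MN : ℝ) ^ 2 * (LN : ℝ) ^ 2 := by
      have h' := mul_le_mul_of_nonneg_right hc hq
      calc c * (nN : ℝ) ^ 2 * (MN : ℝ) ^ 2 * (LN : ℝ) ^ 2 = c * ((nN : ℝ) ^ 2 * (MN : ℝ) ^ 2 * (LN : ℝ) ^ 2) := by ring
        _ ≤ 40 * ((nN : ℝ) ^ 2 * (MN : ℝ) ^ 2 * (LN : ℝ) ^ 2) := h'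
        _ = _ := by ring
    have hA : (0 : ℝ) ≤ 4 * (2 * Real.sqrt N) ^ 2 := by positivity
    have h2 : 0 ≤ 4 * (2 * Real.sqrt N) ^ 2 * (Real.exp (κ * (D + 4)) * Real.exp (-(κ * g))) := by positivity
    calc 4 * (2 * Real.sqrt N) ^ 2 * Real.exp (-(κ * (((g - (D + 2) : ℕ) - 2 : ℕ) : ℝ))) *
          (c * (nN : ℝ) ^ 2 * (MN : ℝ) ^ 2 * (LN : ℝ) ^ 2)
        ≤ 4 * (2 * Real.sqrt N) ^ 2 * (Real.exp (κ * (D + 4)) * Real.exp (-(κ * g))) *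
          (c * (nN : ℝ) ^ 2 * (MN : ℝ) ^ 2 * (LN : ℝ) ^ 2) :=
          mul_le_mul_of_nonneg_right (mul_le_mul_of_nonneg_left he hA) hcq
      _ ≤ 4 * (2 * Real.sqrt N) ^ 2 * (Real.exp (κ * (D + 4)) * Real.exp (-(κ * g))) *
          (40 * (nN : ℝ) ^ 2 * (MN : ℝ) ^ 2 * (LN : ℝ) ^ 2) := mul_le_mul_of_nonneg_left hc' h2
      _ = _ := by ring
  -- the seven bounds
  have B3 := pack (g := min d03 (min d13 d23)) (by norm_num) (by norm_num)
    (abs_fourPoint_le_of_isolated_dim hd hN hK0 hmod hR hdoor h0 hb hμ hF hWq hWr hWs hFM hWq1 hWr1 hnF hnq hnr hns hLF hLW hLW hLW hMF' hMW hMW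
      (U2 (U2 (S03 (by omega)) (S13 (by omega))) (S23 (by omega))))
  have B2 : |U₄[F ; W∗ q ; W∗ r ; W∗ s ; μ]| ≤ P₀ * Real.exp (-(κ * (min d02 (min d12 d23) : ℕ))) := by
    have h := abs_fourPoint_le_of_isolated_dim hd hN hK0 hmod hR hdoor h0 hb hμ hF hWq hWs hWr hFM hWq1 hWs1 hnF hnq hns hnr hLF hLW hLW hLW
      hMF' hMW hMW (m := min d02 (min d12 d23) - (D + 2)) (U2 (U2 (S02 (by omega)) (S12 (by omega))) (S32 (by omega)))
    rw [← fourPoint_swap_zw hF.measurable hWqm hWrm hWsm hFM hWq1 hWr1 hWs1] at h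
    exact pack (by norm_num) (by norm_num) h
  have B1 : |U₄[F ; W∗ q ; W∗ r ; W∗ s ; μ]| ≤ P₀ * Real.exp (-(κ * (min d01 (min d12 d13) : ℕ))) := by
    have h := abs_fourPoint_le_of_isolated_dim hd hN hK0 hmod hR hdoor h0 hb hμ hF hWr hWs hWq hFM hWr1 hWs1 hnF hnr hns hnq hLF hLW hLW hLW
      hMF' hMW hMW (m := min d01 (min d12 d13) - (D + 2)) (U2 (U2 (S01 (by omega)) (S21 (by omega))) (S31 (by omega)))
    rw [← fourPoint_swap_zw hF.measurable hWrm hWqm hWsm hFM hWr1 hWq1 hWs1,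
      ← fourPoint_swap_yz hF.measurable hWqm hWrm hWsm hFM hWq1 hWr1 hWs1] at h
    exact pack (by norm_num) (by norm_num) h
  have B123 : |U₄[F ; W∗ q ; W∗ r ; W∗ s ; μ]| ≤ P₀ * Real.exp (-(κ * (min d01 (min d02 d03) : ℕ))) := by
    have h := abs_fourPoint_le_of_isolated_dim hd hN hK0 hmod hR hdoor h0 hb hμ hWq hWr hWs hF hWq1 hWr1 hWs1 hnq hnr hns hnF hLW hLW hLW hLF
      hMW hMW hMW (m := min d01 (min d02 d03) - (D + 2)) (U2 (U2 (S10 (by omega)) (S20 (by omega))) (S30 (by omega)))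
    rw [← fourPoint_swap_zw hWqm hWrm hF.measurable hWsm hWq1 hWr1 hFM hWs1,
      ← fourPoint_swap_yz hWqm hF.measurable hWrm hWsm hWq1 hFM hWr1 hWs1,
      ← fourPoint_swap_xy hF.measurable hWqm hWrm hWsm hFM hWq1 hWr1 hWs1] at h
    exact pack (by norm_num) (by norm_num) h
  have B23 := pack (g := min d02 (min d03 (min d12 d13))) (by norm_num) (le_refl (40 : ℝ))
    (abs_fourPoint_le_of_pair_dim hd hN hK0 hmod hR hdoor h0 hb hμ hF hWq hWr hWs hFM hWq1 hWr1 hWs1 hnF hnq hnr hns hLF hLW hLW hLW hMF' hMW hMW hMW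
      (U2 (T2 (S02 (by omega)) (S03 (by omega))) (T2 (S12 (by omega)) (S13 (by omega)))))
  have B13 : |U₄[F ; W∗ q ; W∗ r ; W∗ s ; μ]| ≤
      P₀ * Real.exp (-(κ * (min d01 (min d03 (min d12 d23)) : ℕ))) := by
    have h := abs_fourPoint_le_of_pair_dim hd hN hK0 hmod hR hdoor h0 hb hμ hF hWr hWq hWs hFM hWr1 hWq1 hWs1 hnF hnr hnq hns hLF hLW hLW hLW
      hMF' hMW hMW hMW (m := min d01 (min d03 (min d12 d23)) - (D + 2))
      (U2 (T2 (S01 (by omega)) (S03 (by omega))) (T2 (S21 (by omega)) (S23 (by omega))))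
    rw [← fourPoint_swap_yz hF.measurable hWqm hWrm hWsm hFM hWq1 hWr1 hWs1] at h
    exact pack (by norm_num) le_rfl h
  have B12 : |U₄[F ; W∗ q ; W∗ r ; W∗ s ; μ]| ≤
      P₀ * Real.exp (-(κ * (min d01 (min d02 (min d13 d23)) : ℕ))) := by
    have h := abs_fourPoint_le_of_pair_dim hd hN hK0 hmod hR hdoor h0 hb hμ hF hWs hWq hWr hFM hWs1 hWq1 hWr1 hnF hns hnq hnr hLF hLW hLW hLW
      hMF' hMW hMW hMW (m := min d01 (min d02 (min d13 d23)) - (D + 2))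
      (U2 (T2 (S01 (by omega)) (S02 (by omega))) (T2 (S31 (by omega)) (S32 (by omega))))
    rw [← fourPoint_swap_yz hF.measurable hWqm hWsm hWrm hFM hWq1 hWs1 hWr1,
      ← fourPoint_swap_zw hF.measurable hWqm hWrm hWsm hFM hWq1 hWr1 hWs1] at h
    exact pack (by norm_num) le_rfl h
  -- combine the seven splits
  have key := tree_bound_of_seven_splits hP₀0 hκ.le t12 t13 t21 t23 t31 t32 B1 B2 B3 B12 B13 B23 B123
  refine key.trans ?_
  have e1 := exp_neg_ninth_supNorm_le_pow_dim hκ.le (by omega : 1 ≤ d) (x₀ - q.1)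
  have e2 := exp_neg_ninth_supNorm_le_pow_dim hκ.le (by omega : 1 ≤ d) (x₀ - r.1)
  have e3 := exp_neg_ninth_supNorm_le_pow_dim hκ.le (by omega : 1 ≤ d) (x₀ - s.1)
  rw [R01] at e1; rw [R02] at e2; rw [R03] at e3
  have hfin : P₀ = 4 * (2 * Real.sqrt N) ^ 2 * Real.exp (κ * (D + 4)) *
      (40 * ((Λ.card : ℝ) + 4) ^ 2 * (|F 1| + 2 * KF + 1) ^ 2 * ((KF : ℝ) + 4 * (N : ℝ) ^ 3) ^ 2) := by
    rw [hP₀]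
    have en : (nN : ℝ) = Λ.card + 4 := by rw [hnN]; push_cast; ring
    have eL : (LN : ℝ) = KF + 4 * (N : ℝ) ^ 3 := by rw [hLN]; push_cast; ring
    have eM : (MN : ℝ) = |F 1| + 2 * KF + 1 := by rw [hMN]; push_cast; rw [hMFdef]
    rw [en, eL, eM]
  rw [← hfin]
  have hρ0' : 0 ≤ Real.exp (-(κ / (9 * d))) := (Real.exp_pos _).le
  calc P₀ * Real.exp (-(κ / 9 * d01)) * Real.exp (-(κ / 9 * d02)) * Real.exp (-(κ / 9 * d03))
      ≤ P₀ * Real.exp (-(κ / (9 * d))) ^ l1 (x₀ - q.1) * Real.exp (-(κ / (9 * d))) ^ l1 (x₀ - r.1) *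
        Real.exp (-(κ / (9 * d))) ^ l1 (x₀ - s.1) := by
        gcongr

end FourPoint

end Summit.Ventures.YMGap.CouplingResponse

end
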